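import Literature.NumberTheory.EllipticCurves.GoodModelInertiaCriterionProofs
import Literature.NumberTheory.GaloisRepresentations.FiltrationFromIndicesProofs
import Literature.NumberTheory.GaloisRepresentations.RamificationCertificatesProofs
import HarnessLib

/-!
# The wild conductor of `E[3]` from an explicit certificate `(F, C, T, f)`

`Proofs` file (theorems only, no definitions, no named facts) in topic
`NumberTheory/EllipticCurves`, landed by the seat of bsd.S15
(`Literature.NumberTheory.EllipticCurves.conductorNorm_eq_artinConductorNat_of_isElliptic`): the
**one-call interface** of the explicit-field route to the Galois side of Ogg's formula at `2`
(Silverman *ATAEC* Thm. IV.11.1, `p = 2`, PDF p. 366) for the classes with non-abelian inertia.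
Input, all checkable by polynomial identities in the explicit normal field `F ⊆ K̄`:

* a good model `C • E_F` at `𝔓` (coefficients `𝔓`-integral, discriminant a `𝔓`-unit, as fractions
  of absolute integers) — `GoodModelInertiaCriterionProofs`;
* the finset `T` of non-trivial elements of the inertia group `I(𝔓 ∩ F) ≤ Gal(F/K)` with their
  indices `i_G(τ) = f(τ)` — certified by `RamificationCertificatesProofs`
  (`mem_inertia_iff_of_card_eq`, `lowerIndex_eq_ord_smul_sub_of_mem_inertia`);
* for each `τ ∈ T`, fraction representatives of the entries of `A_τ = C (τC)⁻¹` one of whose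
  numerators is a `𝔓`-unit (`A_τ ≢ 1 (mod 𝔓)`: `τ` moves `E[3]`).

Output (`swanConductorAt_torsion_three_eq_of_certificates`):
**`Sw_𝔓(E[3]) = 2 (b + Σ_{τ ∈ T} (f(τ) - 1)) / (#T + 1)`**, `b = max f - 1` — i.e. `2 φ_{F/K}(b)`,
twice the last upper ramification break of `F` at `𝔓 ∩ F` (`FiltrationFromIndicesProofs`).  The
same certificate serves every curve `2`-adically close to `E` (same `C`), which is how a class of
Kodaira–Néron type is covered by finitely many certificates.

## References

* J. H. Silverman, *Advanced Topics in the Arithmetic of Elliptic Curves*, GTM 151 (1994), §IV.10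
  (Definition of `δ`, PDF p. 358), Thm. IV.11.1 (`p = 2`: p. 366). [SilvermanATAEC1994]
* J.-P. Serre, *Local Fields*, GTM 67 (1979), Ch. IV §1, §3, Ch. VI §2. [SerreLocalFields1979]
* J.-P. Serre, J. Tate, *Good reduction of abelian varieties*, Ann. of Math. 88 (1968), §2–§3.
  [SerreTate1968]

## Design

Theorems only; `noncomputable section`; `namespace WeierstrassCurve`.  Axioms: `propext`,
`Classical.choice`, `Quot.sound`.
-/

noncomputable section

open scoped Classical NNReal NumberField Pointwise
open Field IsDedekindDomain MeasureTheory

universe u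

namespace WeierstrassCurve

open Literature.NumberTheory.EllipticCurves Literature.NumberTheory.GaloisRepresentations

variable {K : Type u} [Field K] [NumberField K] (W : WeierstrassCurve K)

attribute [local instance] AddSubgroup.torsionBy.zmodModule

set_option maxHeartbeats 800000 in
/-- **`Sw_𝔓(E[3])` from an explicit certificate.**  Let `E/K` be elliptic, `v ∤ 3`, `𝔓 ∣ v`,
`F/K` a finite normal subextension of `K̄` with `𝔔 = 𝔓 ∩ F`, `C` a change of variables over `F`
such that `C • E_F` is a good model at `𝔓` (hypotheses `ha₁ … ha₆`, `hΔ` of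
`forall_smul_geomTorsion_three_eq_iff_of_goodModel`), `T` the finset of non-trivial elements of
`I(𝔔)` with indices `i(τ) = f(τ)`, `T ≠ ∅`, and suppose that for every `τ ∈ T` the entries of
`A_τ = C (τC)⁻¹` are given as fractions `n/d` (`d ∉ 𝔓`) with some numerator `∉ 𝔓`.  Then
**`Sw_𝔓(E[3]) = 2 · (b + Σ_{τ ∈ T} (f(τ) - 1)) / (#T + 1)`** with `b = max f - 1`.
Proof: an inertia element `σ ∈ I_𝔓` fixes `E[3]` iff `σ|_F = 1` (`σ|_F ∈ I(𝔔)` by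
`inertia_map_absRestrictNormalHom_le`; for `σ|_F = τ ∈ T` the criterion and the unit numerator say
`σ` moves `E[3]`, for `σ|_F = 1` the criterion with `A_1 = 1` says it fixes it); hence
`Sw = 2 · vol {u > 0 : Gal(F/K)^u ≠ 1}` (`swanConductorAt_torsion_three_eq_two_mul_volume_of_forall_iff`),
evaluated by `volume_real_setOf_upperRamificationSubgroup_ne_bot_eq_of_lowerIndex_eq`.
[cite: SilvermanATAEC1994, §IV.10 Definition of δ (PDF p. 358); Thm. IV.11.1, p = 2 (p. 366)]
[cite: SerreLocalFields1979, Ch. IV §3 Lemma 3 and Ch. VI §2] [cite: SerreTate1968, §2–§3] -/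
theorem swanConductorAt_torsion_three_eq_of_certificates [W.IsElliptic]
    {v : HeightOneSpectrum (𝓞 K)} (h3 : (3 : 𝓞 K) ∉ v.asIdeal)
    {𝔓 : Ideal (absIntegers (𝓞 K) K)} (h𝔓 : 𝔓 ∈ v.primesAbove)
    (F : IntermediateField K (AlgebraicClosure K)) [FiniteDimensional K F] [Normal K F]
    (C : VariableChange F)
    (ha₁ : ∃ n d : absIntegers (𝓞 K) K, d ∉ 𝔓 ∧
      (((C • W.baseChange F).a₁ : F) : AlgebraicClosure K) * d = n)
    (ha₂ : ∃ n d : absIntegers (𝓞 K) K, d ∉ 𝔓 ∧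
      (((C • W.baseChange F).a₂ : F) : AlgebraicClosure K) * d = n)
    (ha₃ : ∃ n d : absIntegers (𝓞 K) K, d ∉ 𝔓 ∧
      (((C • W.baseChange F).a₃ : F) : AlgebraicClosure K) * d = n)
    (ha₄ : ∃ n d : absIntegers (𝓞 K) K, d ∉ 𝔓 ∧
      (((C • W.baseChange F).a₄ : F) : AlgebraicClosure K) * d = n)
    (ha₆ : ∃ n d : absIntegers (𝓞 K) K, d ∉ 𝔓 ∧
      (((C • W.baseChange F).a₆ : F) : AlgebraicClosure K) * d = n)
    (hΔ : ∃ n d : absIntegers (𝓞 K) K, n ∉ 𝔓 ∧ d ∉ 𝔓 ∧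
      (((C • W.baseChange F).Δ : F) : AlgebraicClosure K) * d = n)
    (T : Finset (F ≃ₐ[K] F))
    (hT : ∀ τ, τ ∈ T ↔
      τ ∈ (𝔓.comap (F.integralClosureToAbsIntegers (𝓞 K))).inertia (F ≃ₐ[K] F) ∧ τ ≠ 1)
    (hTne : T.Nonempty) (f : (F ≃ₐ[K] F) → ℕ)
    (hf : ∀ τ ∈ T,
      lowerIndex (𝔓.comap (F.integralClosureToAbsIntegers (𝓞 K))) (F ≃ₐ[K] F) τ = f τ)
    (hA : ∀ τ ∈ T, ∃ nu du nr dr ns ds nt dt : absIntegers (𝓞 K) K,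
      du ∉ 𝔓 ∧ dr ∉ 𝔓 ∧ ds ∉ 𝔓 ∧ dt ∉ 𝔓 ∧
      ((((C * (C.map (τ : F →+* F))⁻¹).u : F) : AlgebraicClosure K) - 1) * du = nu ∧
      (((C * (C.map (τ : F →+* F))⁻¹).r : F) : AlgebraicClosure K) * dr = nr ∧
      (((C * (C.map (τ : F →+* F))⁻¹).s : F) : AlgebraicClosure K) * ds = ns ∧
      (((C * (C.map (τ : F →+* F))⁻¹).t : F) : AlgebraicClosure K) * dt = nt ∧
      (nu ∉ 𝔓 ∨ nr ∉ 𝔓 ∨ ns ∉ 𝔓 ∨ nt ∉ 𝔓)) :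
    (W.torsionGaloisRep 3).swanConductorAt (𝓞 K) 𝔓 =
      2 * ((((T.sup f - 1 : ℕ) : ℝ) + ∑ τ ∈ T, ((f τ : ℝ) - 1)) / (T.card + 1)) := by
  set 𝔔 := 𝔓.comap (F.integralClosureToAbsIntegers (𝓞 K)) with h𝔔
  -- (1) an inertia element fixes `E[3]` iff it restricts to `1` on `F`
  have hN : ∀ σ : absoluteGaloisGroup K, σ ∈ 𝔓.inertia (absoluteGaloisGroup K) →
      ((∀ P : geomTorsion W (3 : ℕ), σ • P = P) ↔
        absRestrictNormalHom F σ ∈ ({1} : Set (F ≃ₐ[K] F))) := by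
    intro σ hσ
    rw [Set.mem_singleton_iff]
    have hτI : absRestrictNormalHom F σ ∈ 𝔔.inertia (F ≃ₐ[K] F) :=
      inertia_map_absRestrictNormalHom_le 𝔓 F (Subgroup.mem_map_of_mem _ hσ)
    by_cases hτ1 : absRestrictNormalHom F σ = 1
    · -- `A_1 = 1`: the criterion says `σ` fixes `E[3]`
      refine iff_of_true ?_ hτ1
      have hA1 : C * (C.map (absRestrictNormalHom F σ : F →+* F))⁻¹ = 1 := by
        rw [hτ1]
        have : (C.map ((1 : F ≃ₐ[K] F) : F →+* F)) = C := by
          change C.map (RingHom.id F) = C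
          exact VariableChange.map_id C
        rw [this, mul_inv_cancel]
      have key := W.forall_smul_geomTorsion_three_eq_iff_of_goodModel h3 h𝔓 F C ha₁ ha₂ ha₃ ha₄
        ha₆ hΔ hσ (nu := 0) (du := 1) (nr := 0) (dr := 1) (ns := 0) (ds := 1) (nt := 0) (dt := 1)
        (fun h ↦ ?_) (fun h ↦ ?_) (fun h ↦ ?_) (fun h ↦ ?_) ?_ ?_ ?_ ?_
      · exact key.mpr ⟨zero_mem _, zero_mem _, zero_mem _, zero_mem _⟩
      all_goals first
        | exact (Ideal.ne_top_iff_one 𝔓).mp (Ideal.IsPrime.ne_top h𝔓.1) h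
        | (rw [hA1]; simp [VariableChange.one_def])
    · -- `σ|_F = τ ∈ T`: some entry of `A_τ` is a unit, so `σ` moves `E[3]`
      refine iff_of_false ?_ hτ1
      have hτT : absRestrictNormalHom F σ ∈ T := (hT _).mpr ⟨hτI, hτ1⟩
      obtain ⟨nu, du, nr, dr, ns, ds, nt, dt, hdu, hdr, hds, hdt, eu, er, es, et, hunit⟩ :=
        hA _ hτT
      have key := W.forall_smul_geomTorsion_three_eq_iff_of_goodModel h3 h𝔓 F C ha₁ ha₂ ha₃ ha₄
        ha₆ hΔ hσ hdu hdr hds hdt eu er es et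
      rw [key]
      rintro ⟨h1, h2, h3', h4⟩
      rcases hunit with h | h | h | h
      · exact h h1
      · exact h h2
      · exact h h3'
      · exact h h4
  -- (2) `Sw = 2 · vol {u > 0 : Gal(F/K)^u ≠ 1}`
  rw [W.swanConductorAt_torsion_three_eq_two_mul_volume_of_forall_iff h3 h𝔓 F {1} hN]
  congr 1
  have hset : {u : ℝ | 0 < u ∧ ∃ τ ∈ upperRamificationSubgroup 𝔔 (F ≃ₐ[K] F) u,
      τ ∉ ({1} : Set (F ≃ₐ[K] F))} =
      {u : ℝ | 0 < u ∧ upperRamificationSubgroup 𝔔 (F ≃ₐ[K] F) u ≠ ⊥} := by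
    ext u
    simp only [Set.mem_setOf_eq, Set.mem_singleton_iff]
    refine and_congr_right fun _ ↦ ?_
    rw [Subgroup.ne_bot_iff_exists_ne_one]
    constructor
    · rintro ⟨τ, hτ, hτ1⟩; exact ⟨⟨τ, hτ⟩, fun h ↦ hτ1 (congrArg Subtype.val h)⟩
    · rintro ⟨⟨τ, hτ⟩, hτ1⟩; exact ⟨τ, hτ, fun h ↦ hτ1 (Subtype.ext h)⟩
  rw [hset]
  -- (3) evaluate through the indices
  have hT' : ∀ τ, τ ∈ T ↔ τ ∈ 𝔔.ramificationSubgroup (F ≃ₐ[K] F) 0 ∧ τ ≠ 1 := fun τ ↦ by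
    rw [Ideal.ramificationSubgroup_zero]; exact hT τ
  exact volume_real_setOf_upperRamificationSubgroup_ne_bot_eq_of_lowerIndex_eq 𝔔 T hT' hTne f hf

end WeierstrassCurve

end
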